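import Mathlib

/-!
# Route EIHFluxBalance — `InertialRecession`, line `sublinear-is-free-clean-window-charges`:
# the absorption arithmetic of the slaving assembly, uniform coercivity of compact families of
# injective linear maps, and the shape of the coercivity statement COER (slaving stub `stub_slaving`)

Helper file for the crux `stmt-FinalStateConjecture-10166`
(`Summit.FinalStateConjecture.FinalStateConjecture.Theses.EIHFluxBalance.InertialRecession`),
stub `stub_slaving`. Mathlib-only.

## What the assembly of `SLAVED³` has to absorb, and why COER must be NONLINEAR

Near hole `i` the frozen ansatz is `g₀ = Sᵢ + Pᵢ` (own painted summand + far fields of the other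
holes) and the landed `C²` capstone (`…StubSlaving3RicciNearHole.exists_abs_ricAt_ansatz_le_jet`)
gives `|Ric(g₀)(x)| ≤ ε (1 + ‖Dg₀‖² + ‖D²g₀‖)` on the tube: a bound RELATIVE to the `2`-jet, because
the painted jets `J¹ = (u̇, δ = ξ̇ − v(u), axis rate)`, `J² = (ü, δ̇, …)` are not bounded a priori and
`‖Dg₀‖ ≲ 1 + |J¹|`, `‖D²g₀‖ ≲ 1 + |J¹|² + |J²|`. The Ricci form of ONE painted summand at a point
of the slab `{x⁰ = t}` is EXACTLY a polynomial of degree two in the jets at `t`,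
`Ric(S_J)(x) = A_x J¹ + B_x J² + Q_x(J¹, J¹)` (`A, B` linear, `Q` quadratic, no `J¹J²` or `J²J²`
terms, zero constant term by the zero set F1, `…StubSlaving3ZeroSet`). Consequently a merely LINEAR
coercivity `|J| ≤ C sup |A J¹ + B J²|` does NOT close the argument: with `|J¹| ~ 1/ε`,
`|J²| ~ 1/ε²` the principal part `B J² + Q(J¹)` may nearly cancel while `|Ric| ~ |A J¹| ~ 1/ε` still
satisfies the relative bound `≤ ε (1 + |J¹|² + |J²|)`; continuity in `t` only propagates the
dichotomy "jets `≲ ε` or jets `≳ 1/ε`", it does not decide it. What closes it is the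
weighted-homogeneous NONLINEAR coercivity (parabolic weights `1, 2` on `J¹, J²`)

  NLCOER: `c · min(|J|, 1) · (1 + |J¹|² + |J²|) ≤ max over finitely many annulus points xₖ and unit
  `Y, Z` of |Ric(S_J)(xₖ)(Y, Z)|`, uniformly for `|u⁰| ≤ γ` (and all axes),

and then `small_of_weighted_coercive` below turns the relative bound into `|J| ≤ ε C₁ / c` with NO
continuity argument (the factor `1 + |J¹|² + |J²|` cancels). NLCOER is equivalent to the
conjunction of three finite-dimensional facts about the explicit polynomials `J ↦ Ric(S_J)(xₖ)`:
(COER₁) the linear part `J ↦ (A J¹ + B J²)ₖ` is injective modulo the Kerr–Schild stabiliser;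
(COER₂) the principal part `(Ĵ¹, Ĵ²) ↦ (B Ĵ² + Q(Ĵ¹))ₖ` has no non-trivial zero; (COER_s) no
non-zero jet is an exact zero — and COER_s follows from the structure of the momentum constraint:
the mixed Einstein components `G⁰ᵢ(S_J)(xₖ)` are EXACTLY LINEAR in `J¹` (no `J²`, no quadratic
terms: the momentum constraint is affine in `∂₀g` with coefficients built from spatial derivatives)
and injective modulo the stabiliser, so `Ric ≡ 0 ⇒ J¹ = 0 ⇒ B J² = 0 ⇒ J² = 0`.

Exact rational verification (worker of lead c1, 2026-08-16; pure-python engine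
`work/compute/coer_exact.py`, `coer_kerr.py` in the lead's folder: truncated multivariate Taylor
arithmetic over `ℚ` for the painted Kerr–Schild summand, Christoffels and `Ric` at rational points
with rational painted radius; the engine reproduces F1, `Ric = 0` at zero jets, for Schwarzschild
AND Kerr): with `M = 1`, at `6–40` rational points of painted radius `3 … 13` (Schwarzschild, `r₊ = 2`) resp.
`0.8 … 3` (Kerr, `a = 3/5`, `r₊ = 1.8`; ranks of such analytic families are generic, so any open
set of points, e.g. outside the horizon, gives the same), for the rest frame and for the boost
`u = (5/4, 3/4, 0, 0)`:
* Schwarzschild: linear part rank `12/12` in the invariant jets `(u̇, δ ∣ ü^⊥, δ̇)`; `J²`-block rank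
  `6/6`; `J¹ ↦ G⁰ᵢ` rank `6/6` and `G⁰ᵢ` exactly linear in `J¹`; the projected principal quadratic
  forms span ALL `21` quadratic forms in `J¹` (so COER₂ holds with no computation left);
* Kerr `a = 3/5`: in the `18` generator jets `(boost, rotation, centre) × (orders 1, 2)` the linear
  part has rank `16 = 18 − 2` (exactly the body-axis rotation rate and its derivative are
  invisible), `J²`-block `8/9`, `J¹ ↦ G⁰ᵢ` rank `8/9`, `G⁰ᵢ` exactly linear; the projected
  principal forms span `35` of the `36` gauge-invariant quadratic forms, the missing functional
  being INDEFINITE (`d₃² − (25/9)(w₁² + w₂²) + (mixed bᵢdⱼ terms)`, `w` = axis rates, `d` = centre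
  mismatch, `b` = boost rates), so again no common zero: COER₂.
So NLCOER holds at these parameters for all spins tested; what is not in Lean is the symbolic
`2`-jet of the painted summand at rational points (closed forms for `∂S`, `∂²S` as polynomials in the
jets), after which COER₁/COER₂/COER-mom are finite rational certificates (left inverses and
spanning combinations) checkable by `norm_num`, and uniformity in `u` over `{|u⁰| ≤ γ}` follows from
`exists_bound_of_forall_injective` below (continuity + compactness) once injectivity is known for
every `u` (one symbolic parameter after a spatial rotation).

Orders: NLCOER with the `C²` capstone slaves orders `1, 2`; order `3` is then LINEAR
(`∂₀ Ric(S) = A J² + B J³ + (small)`, same injective `B`) against the `C³` capstone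
`…StubSlaving11RicciC3.exists_norm_fderiv_ricAt_ansatz_le_zoom`, absorbed by
`small_of_relative_linear`. Cross-hole terms enter hole `i`'s inequality with the factor
`Mⱼ/Dᵢⱼ → 0` times `(1 + |Jⱼ¹|² + |Jⱼ²|)` (degree law `…StubSlaving3JetScaling`), and are absorbed by
running the argument at the hole with the LARGEST weighted jet.

## Contents (all elementary)

* `small_of_relative_linear` — `0 ≤ J ≤ C r`, `r ≤ ε (1 + J)`, `C ε ≤ 1/2` ⇒ `J ≤ 2 C ε`;
* `small_of_weighted_coercive` — the NLCOER absorption: `c min(n,1)(1+w) ≤ Φ ≤ ε C₁ (1+w)`,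
  `ε C₁ < c` ⇒ `n ≤ ε C₁ / c`;
* `exists_bound_of_forall_injective` — a continuous family of injective linear maps on a
  finite-dimensional space, over a compact parameter set, is uniformly bounded below.
-/

-- the doubled `FinalStateConjecture.FinalStateConjecture` path component trips dupNamespace
set_option linter.dupNamespace false

namespace Summit.FinalStateConjecture.FinalStateConjecture.Theorems.SublinearIsFree.Slaving

/-! ### Absorption arithmetic -/

/-- **Linear absorption**: if `J ≤ C r` (linear coercivity), `r ≤ ε (1 + J)` (relative smallness,
linear in the jet) and `C ε ≤ 1/2`, then `J ≤ 2 C ε`. This is the order-`3` step of the slaving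
assembly (and the order-`1` step of the momentum-constraint route). [folklore] -/
theorem small_of_relative_linear {J C r ε : ℝ} (hJ : 0 ≤ J) (hC : 0 ≤ C) (hJr : J ≤ C * r)
    (hr : r ≤ ε * (1 + J)) (hCε : C * ε ≤ 1 / 2) : J ≤ 2 * C * ε := by
  have h1 : J ≤ C * (ε * (1 + J)) := hJr.trans (mul_le_mul_of_nonneg_left hr hC)
  have h2 : C * ε * J ≤ 1 / 2 * J := mul_le_mul_of_nonneg_right hCε hJ
  have h3 : C * (ε * (1 + J)) = C * ε + C * ε * J := by ring
  rw [h3] at h1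
  linarith

/-- **Weighted (nonlinear) absorption**, the NLCOER step of the slaving assembly: if
`c · min(n, 1) · (1 + w) ≤ Φ` (weighted-homogeneous coercivity of the jet ↦ Ricci map, `n` the jet
norm, `w ≥ 0` its parabolic weight `|J¹|² + |J²|`), `Φ ≤ ε C₁ (1 + w)` (relative smallness of the
Ricci form) and `ε C₁ < c`, then `n ≤ ε C₁ / c` — the large-jet branch is excluded outright and no
continuity argument is needed. [folklore] -/
theorem small_of_weighted_coercive {n w c C₁ ε Φ : ℝ} (hw : 0 ≤ w) (hc : 0 < c)
    (hcoer : c * min n 1 * (1 + w) ≤ Φ) (hΦ : Φ ≤ ε * C₁ * (1 + w)) (hε : ε * C₁ < c) :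
    n ≤ ε * C₁ / c := by
  have h1w : 0 < 1 + w := by linarith
  have key : c * min n 1 ≤ ε * C₁ := le_of_mul_le_mul_right (hcoer.trans hΦ) h1w
  have hn1 : n < 1 := by
    by_contra h
    push Not at h
    rw [min_eq_right h] at key
    linarith
  rw [min_eq_left hn1.le] at key
  rw [le_div_iff₀ hc]
  linarith

/-! ### Uniform coercivity of compact families of injective linear maps -/

/-- **A compact continuous family of injective linear maps on a finite-dimensional space is
uniformly coercive**: if `L : P → (F →L[ℝ] G)` is continuous on a compact set `K` and every `L p`,
`p ∈ K`, is injective (`F` finite-dimensional), then there is `C` with `‖v‖ ≤ C ‖L p v‖` for all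
`p ∈ K` and all `v` (the continuous positive function `(p, v) ↦ ‖L p v‖` attains a positive minimum
on `K ×` the unit sphere). This is how pointwise algebraic coercivity of the jet ↦ Ricci map of one
painted summand becomes uniform over the compact set of painted `4`-velocities `{|u⁰| ≤ γ}` (and
axes). [folklore] -/
theorem exists_bound_of_forall_injective {P F G : Type*} [TopologicalSpace P]
    [NormedAddCommGroup F] [NormedSpace ℝ F] [FiniteDimensional ℝ F]
    [NormedAddCommGroup G] [NormedSpace ℝ G] {K : Set P} (hK : IsCompact K)
    {L : P → F →L[ℝ] G} (hL : ContinuousOn L K) (hinj : ∀ p ∈ K, Function.Injective (L p)) :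
    ∃ C : ℝ, 0 ≤ C ∧ ∀ p ∈ K, ∀ v : F, ‖v‖ ≤ C * ‖L p v‖ := by
  -- the compact set `K × sphere`
  set S : Set (P × F) := K ×ˢ Metric.sphere (0 : F) 1 with hS
  have hSc : IsCompact S := hK.prod (isCompact_sphere 0 1)
  by_cases hSe : S = ∅
  · -- no unit vectors (or no parameters): the bound is vacuous / trivial
    refine ⟨0, le_rfl, fun p hp v ↦ ?_⟩
    by_cases hv : v = 0
    · simp [hv]
    · exfalso
      have hmem : (p, ‖v‖⁻¹ • v) ∈ S := by
        refine ⟨hp, ?_⟩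
        rw [mem_sphere_zero_iff_norm, norm_smul, norm_inv, norm_norm,
          inv_mul_cancel₀ (norm_ne_zero_iff.2 hv)]
      rw [hSe] at hmem
      exact hmem
  -- the continuous positive function `(p, v) ↦ ‖L p v‖` on `S`
  have hf : ContinuousOn (fun q : P × F ↦ ‖L q.1 q.2‖) S := by
    refine ContinuousOn.norm ?_
    have h1 : ContinuousOn (fun q : P × F ↦ L q.1) S := hL.comp continuousOn_fst fun q hq ↦ hq.1
    exact h1.clm_apply continuousOn_snd
  obtain ⟨q₀, hq₀, hmin⟩ := hSc.exists_isMinOn (Set.nonempty_iff_ne_empty.2 hSe) hf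
  set μ : ℝ := ‖L q₀.1 q₀.2‖ with hμ
  have hq₀2 : ‖q₀.2‖ = 1 := mem_sphere_zero_iff_norm.1 hq₀.2
  have hμ0 : 0 < μ := by
    rw [hμ, norm_pos_iff]
    intro h0
    have h1 : q₀.2 = 0 := hinj q₀.1 hq₀.1 (by rw [h0, map_zero])
    rw [h1, norm_zero] at hq₀2
    exact zero_ne_one hq₀2
  refine ⟨μ⁻¹, inv_nonneg.2 hμ0.le, fun p hp v ↦ ?_⟩
  by_cases hv : v = 0
  · simp [hv]
  have hvn : 0 < ‖v‖ := norm_pos_iff.2 hv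
  have hmem : (p, ‖v‖⁻¹ • v) ∈ S := by
    refine ⟨hp, ?_⟩
    rw [mem_sphere_zero_iff_norm, norm_smul, norm_inv, norm_norm, inv_mul_cancel₀ hvn.ne']
  have h1 : μ ≤ ‖L p (‖v‖⁻¹ • v)‖ := hmin hmem
  rw [map_smul, norm_smul, norm_inv, norm_norm] at h1
  rw [inv_mul_eq_div, le_div_iff₀ hμ0]
  calc ‖v‖ * μ ≤ ‖v‖ * (‖v‖⁻¹ * ‖L p v‖) := mul_le_mul_of_nonneg_left h1 hvn.le
    _ = ‖L p v‖ := by field_simp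

/-- **Registered one-line carrier form** (`slaving_uniform_coercive_of_injective_slaving11`) of
`exists_bound_of_forall_injective`. [folklore] -/
theorem slaving_uniform_coercive_of_injective_slaving11 : ∀ {P F G : Type*} [TopologicalSpace P] [NormedAddCommGroup F] [NormedSpace ℝ F] [FiniteDimensional ℝ F] [NormedAddCommGroup G] [NormedSpace ℝ G] {K : Set P}, IsCompact K → ∀ {L : P → F →L[ℝ] G}, ContinuousOn L K → (∀ p ∈ K, Function.Injective (L p)) → ∃ C : ℝ, 0 ≤ C ∧ ∀ p ∈ K, ∀ v : F, ‖v‖ ≤ C * ‖L p v‖ :=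
  fun hK _ hL hinj ↦ exists_bound_of_forall_injective hK hL hinj

end Summit.FinalStateConjecture.FinalStateConjecture.Theorems.SublinearIsFree.Slaving
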